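import Summits.BirchSwinnertonDyer.BirchSwinnertonDyer.Theses.KatoDescentPotSupersingular
import Summits.BirchSwinnertonDyer.BirchSwinnertonDyer.Theorems.KatoDescentPotSupersingularWildLowerHalfRankZero
import Summits.BirchSwinnertonDyer.BirchSwinnertonDyer.Theorems.KatoDescentPotSupersingularWildLowerKimRoad
import Summits.BirchSwinnertonDyer.BirchSwinnertonDyer.Theorems.KatoDescentPotSupersingularWildLowerCMRows
import HarnessLib

/-!
# Route `KatoDescentPotSupersingular` (rung K9, cell `bsd-potss`): the STUBS of skeleton v3 of the crux
# `WildLowerHalfRankZero` (L₀, item stmt-BirchSwinnertonDyer-19195) from their displayed inputs, and the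
# v3 composition (a `--supports … --as helper` file)

The registered BC3 skeleton v3 of the item (planner bsd-potss-plan g10, evidence 2026-08-26T03:35Z,
`Cruxes/WildLowerHalfRankZero` namespace `…Birth`) cuts the crux, after the unit-member classes (closed
over Cassels/GZK/modularity by generation 0), into four ROAD STUBS on intrinsic classes + one cite-level
stub + the BC5 rung. None of the four is a theorem of the published record; each is EXACTLY one displayed
input away, and this file proves each registered SIGNATURE (written out: the skeleton's `Intrinsic W`,
`KimRows W` unfold to the binders below) from that input:

* `Sig.stub_lower_irred_fwLocus` ⟸ the Fouquet–Wan CLAIM shape (arXiv:2107.13726 Thm. 5.1, PRE) + the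
  image-free torsion-free readings of Kato's printed theorems (generation 0 §4);
* `Sig.stub_lower_kimRows` ⟸ rung W2's leaf `N11.KimAtThreeRankZeroPUB` (Kim, PRE) + a modular
  parametrisation with `3`-adic-unit period transfer and a UNIT KURIHARA NUMBER per row (generation 0,
  Kim road);
* `Sig.stub_lower_irred_residual` ⟸ Kato's Main Conjecture 12.10 at `3` (interface `KMC`, statement
  level only: `defn-KatoMainConjecture` was ruled programme-sized 2026-08-26T03:32Z) AT THE ROW ITSELF
  (`E[3]` irreducible ⇒ `3 ∤ #E(ℚ)_tors`, so the curve is its own torsion-free member) + readings, CM rows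
  by Burungale–Flach (this generation's `…WildLowerCMRows`);
* `Sig.stub_lower_red_intrinsic` ⟸ KMC₃ at the `3`-TORSION-FREE MEMBERS (Mazur–Kenku) + readings +
  Cassels' transport, CM rows by Burungale–Flach;
* the composition `wildLowerHalfRankZero_of_v3Roads`: the crux BY NAME from the published inputs
  (Cassels, GZK, modularity, Mazur–Kenku, Burungale–Flach), the two PRE inputs (FW claim, Kim's leaf +
  Kurihara units) and KMC₃ displayed on EXACTLY the two non-CM residual row sets — the sharpest kernel
  statement of what the item needs beyond print.

CONDITIONAL throughout (audit `proof.conditional`); the item is NOT closed; nothing is booked.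
Seat `bsd-potss-k9-c2` (prover-bsd-potss-k9-c2-g2-0), generation 2.

References: [FouquetWan2021] Thm. 5.1; [Kim2025RefinedTNC] Thm. 1.1/1.2; [Kurihara2014] §1;
[Kato2004Asterisque] Conj. 12.10 (p. 224), Prop. 14.16 (2) (p. 244); [BurungaleFlach2024] Thm. 1.1 + Cor. 2;
[MilneADT2006] Thm. I.7.3; [SilvermanAEC2009] IX.6 Ex. 6.4 (Mazur–Kenku); [Miller2011LMS] Def. 1.1.
-/

set_option autoImplicit false
-- sibling precedent (`KatoDescentPotSupersingularAssembly.lean`): the directory name repeats the summit name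
set_option linter.dupNamespace false

noncomputable section

open scoped Classical

namespace Summit.BirchSwinnertonDyer.BirchSwinnertonDyer.Theorems

open WeierstrassCurve Literature.NumberTheory.EllipticCurves
  Literature.NumberTheory.EllipticCurves.ModularForms
  Literature.NumberTheory.EllipticCurves.Rank1Residual
  Literature.NumberTheory.EllipticCurves.Rank1Residual.Typed
  Summit.BirchSwinnertonDyer.Rank1Residual.Additive
  Summit.BirchSwinnertonDyer.Rank1Residual
  Summit.BirchSwinnertonDyer.BirchSwinnertonDyer.Theses.KatoDescentPotSupersingular

variable {IsOf : ∀ (W : WeierstrassCurve ℚ) [W.IsElliptic] [W.IsGloballyMinimal] (p : ℕ) [Fact p.Prime],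
  KatoDescentDatum p → Prop}
variable {KMC : ∀ (W : WeierstrassCurve ℚ) [W.IsElliptic] [W.IsGloballyMinimal] (p : ℕ), Prop}

/-! ## §1 `stub_lower_irred_fwLocus` from the Fouquet–Wan claim shape + readings -/

/-- **`Sig.stub_lower_irred_fwLocus` (registered v3 signature, `Intrinsic W` written out) from the
announced claim and the torsion-free readings**: generation 0's `missingLowerBoundAt_wild_of_fwClaim_of_readings`
(FW Thm. 5.1 shape `hFW` over the interface `KMC` ⇒ `KMC W 3` on `X4 ∧ LocIrr ∧ FWNonsplitRam`; the curve
is its own torsion-free member; readings 1♭/3♭ + interface lemma + GZK + modularity give `BSD₃`). The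
intrinsic hypothesis is not needed on this road. Conditional (PRE claim + reading schemata); nothing credited.
[cite: FouquetWan2021, Thm. 5.1 and Thm. 1.7 (p. 5)] [cite: Kato2004Asterisque, Conj. 12.10 (p. 224), Prop. 14.16 (2) (p. 244)] -/
theorem stub_lower_irred_fwLocus_of_fwClaim_of_readings (hFW : FouquetWanClaimShape KMC)
    (hR : TorsionFree.DescentCountReading IsOf) (hreal : TorsionFree.RealizableOfKMC IsOf KMC)
    (hread : ReadsTrivialKMC IsOf KMC) (hGZK : rank_eq_analyticRank_of_analyticRank_le_one)
    (hmod : hasEntireLFunction_rat) :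
    ∀ (W : WeierstrassCurve ℚ) [W.IsElliptic] [W.IsGloballyMinimal] [Fact (3 : ℕ).Prime],
      W.analyticRank = 0 → ClassO6 W 3 → Irr W 3 → (LocIrr W 3 ∧ FWNonsplitRam W 3) →
      (∀ (W' : WeierstrassCurve ℚ) [W'.IsElliptic] [W'.IsGloballyMinimal], IsIsogenous W W' →
        ∀ q' : ℚ, shaAn W' = (q' : ℂ) → 0 < padicValRat 3 q') → MissingLowerBoundAt W 3 :=
  fun W _ _ _ hr hO hI hloc _ ↦
    missingLowerBoundAt_wild_of_fwClaim_of_readings hFW hR hreal hread hGZK hmod W hr hO hI hloc.1 hloc.2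

/-! ## §2 `stub_lower_kimRows` from rung W2's leaf + a unit Kurihara number per row -/

/-- **`Sig.stub_lower_kimRows` (registered v3 signature, `KimRows W` written out) from Kim's leaf and
Kurihara units**: generation 0's `lower_irred_towerSurj_of_kimAtThree_of_kuriharaUnits` with the row
predicate packaged as the skeleton's conjunction. `hKim` = rung W2's `@[conjecture]` leaf (Kim 2025, PRE),
`hKur` = per row a modular parametrisation with `3`-adic-unit period transfer and a unit Kurihara number
(class-wide: Kurihara's conjecture ⟺ KMC by Kim's Conj. 1.3). Conditional; nothing credited.
[cite: Kim2025RefinedTNC, Thm. 1.1/1.2] [cite: Kurihara2014, §1] [cite: Kim2022StructureSelmer, Conj. 1.3] -/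
theorem stub_lower_kimRows_of_kimAtThree_of_kuriharaUnits (hKim : N11.KimAtThreeRankZeroPUB)
    (hGZK : rank_eq_analyticRank_of_analyticRank_le_one) (hmod : hasEntireLFunction_rat)
    (hKur : ∀ (W : WeierstrassCurve ℚ) [W.IsElliptic] [W.IsGloballyMinimal],
      W.analyticRank = 0 → ClassO6 W 3 → (∀ n : ℕ, W.HasSurjectiveModNGaloisRep (3 ^ n : ℕ)) →
      Nat.card {Q : (W.baseChange ℚ_[3]).toAffine.Point // (3 : ℕ) • Q = 0} = 1 →
      ¬ 3 ∣ W.tamagawaProduct →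
        ∃ (N : ℕ) (_ : NeZero N) (D : ModularParametrizationData W N),
          (∃ u : ℚ, ‖(u : ℚ_[3])‖ = 1 ∧ W.realPeriodRat = u * plusPeriod D.f) ∧
            X4.KuriharaUnitAt W 3 D.f) :
    ∀ (W : WeierstrassCurve ℚ) [W.IsElliptic] [W.IsGloballyMinimal] [Fact (3 : ℕ).Prime],
      W.analyticRank = 0 → ClassO6 W 3 →
      ((∀ n : ℕ, W.HasSurjectiveModNGaloisRep (3 ^ n : ℕ)) ∧
        Nat.card {Q : (W.baseChange ℚ_[3]).toAffine.Point // (3 : ℕ) • Q = 0} = 1 ∧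
        ¬ 3 ∣ W.tamagawaProduct) → MissingLowerBoundAt W 3 :=
  fun W _ _ _ hr hO hK ↦
    lower_irred_towerSurj_of_kimAtThree_of_kuriharaUnits hKim hGZK hmod hKur W hr hO hK.1 hK.2.1 hK.2.2

/-! ## §3 `stub_lower_irred_residual` from KMC₃ at the rows themselves (non-CM) and Burungale–Flach (CM) -/

/-- **`Sig.stub_lower_irred_residual` (registered v3 signature) from KMC₃ AT ITS NON-CM ROWS + the
torsion-free readings + the published CM inputs.** On an irreducible row `3 ∤ #E(ℚ)_tors`
(`not_dvd_torsionOrder_of_irr`), so the curve is its own torsion-free member and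
`TorsionFree.missingPPartAt_rankZero_of_kmc` (readings 1♭/3♭, interface lemma, GZK, modularity) turns
`KMC W 3` into `BSD₃` — no Mazur–Kenku, no Cassels; the CM rows are Burungale–Flach
(`lower_irred_residual_of_cmFacts_of_nonCM`). The displayed `hK` is Kato's Conj. 12.10 at `3` on EXACTLY
the non-CM residual rows (off the Fouquet–Wan locus, not Kim rows, intrinsic): the open residue, nothing in
print or announced. Conditional; nothing credited.
[cite: Kato2004Asterisque, Conj. 12.10 (p. 224), Prop. 14.16 (2) (p. 244)] [cite: BurungaleFlach2024, Thm. 1.1 and Cor. 2 (p. 4)]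
[cite: Mazur1977, Ch. III §5, p. 157] -/
theorem stub_lower_irred_residual_of_kmcThree_of_cmFacts (hR : TorsionFree.DescentCountReading IsOf)
    (hreal : TorsionFree.RealizableOfKMC IsOf KMC) (hread : ReadsTrivialKMC IsOf KMC)
    (hGZK : rank_eq_analyticRank_of_analyticRank_le_one) (hmod : hasEntireLFunction_rat)
    (hCM : bsdTriple_of_hasCM_of_L_one_ne_zero)
    (hK : ∀ (W : WeierstrassCurve ℚ) [W.IsElliptic] [W.IsGloballyMinimal] [Fact (3 : ℕ).Prime],
      W.analyticRank = 0 → ClassO6 W 3 → Irr W 3 → ¬ (LocIrr W 3 ∧ FWNonsplitRam W 3) →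
      ¬ ((∀ n : ℕ, W.HasSurjectiveModNGaloisRep (3 ^ n : ℕ)) ∧
        Nat.card {Q : (W.baseChange ℚ_[3]).toAffine.Point // (3 : ℕ) • Q = 0} = 1 ∧
        ¬ 3 ∣ W.tamagawaProduct) → ¬ W.HasCM →
      (∀ (W' : WeierstrassCurve ℚ) [W'.IsElliptic] [W'.IsGloballyMinimal], IsIsogenous W W' →
        ∀ q' : ℚ, shaAn W' = (q' : ℂ) → 0 < padicValRat 3 q') → KMC W 3) :
    ∀ (W : WeierstrassCurve ℚ) [W.IsElliptic] [W.IsGloballyMinimal] [Fact (3 : ℕ).Prime],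
      W.analyticRank = 0 → ClassO6 W 3 → Irr W 3 → ¬ (LocIrr W 3 ∧ FWNonsplitRam W 3) →
      ¬ ((∀ n : ℕ, W.HasSurjectiveModNGaloisRep (3 ^ n : ℕ)) ∧
        Nat.card {Q : (W.baseChange ℚ_[3]).toAffine.Point // (3 : ℕ) • Q = 0} = 1 ∧
        ¬ 3 ∣ W.tamagawaProduct) →
      (∀ (W' : WeierstrassCurve ℚ) [W'.IsElliptic] [W'.IsGloballyMinimal], IsIsogenous W W' →
        ∀ q' : ℚ, shaAn W' = (q' : ℂ) → 0 < padicValRat 3 q') → MissingLowerBoundAt W 3 :=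
  lower_irred_residual_of_cmFacts_of_nonCM hCM hmod fun W _ _ _ hr hO hI hloc hKim hcm hint ↦
    (lower_and_upper_of_missingPPartAt W 3 (TorsionFree.missingPPartAt_rankZero_of_kmc W 3 hR hreal
      hread hGZK hmod hr (by decide) hO.2.1 hO.padicValRat_j_nonneg (not_dvd_torsionOrder_of_irr W 3 hI)
      (hK W hr hO hI hloc hKim hcm hint))).1

/-! ## §4 `stub_lower_red_intrinsic` from KMC₃ at the torsion-free members (non-CM) and Burungale–Flach (CM) -/

/-- **`Sig.stub_lower_red_intrinsic` (registered v3 signature) from KMC₃ AT THE `3`-TORSION-FREE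
ADDITIVE POTENTIALLY GOOD RANK-`0` CURVES + readings + Cassels/GZK/modularity/Mazur–Kenku + the published
CM inputs.** A reducible wild class has `3 ∣ #E(ℚ)_tors` at some members, where Kato's `H⁰` terms do not
vanish; Mazur–Kenku gives a torsion-free member (`Addv.exists_torsionFree_member`), KMC₃ there gives its
`BSD₃` (readings), and Cassels transports the lower half back — generation 0's
`wildLowerHalfRankZero_of_kmcThree_torsionFree`, here restricted to the stub's rows, CM rows by
Burungale–Flach. The displayed `hK` (KMC₃ on the torsion-free additive potentially good rank-`0` curves
at `3`) is the open residue on the 144 non-CM reducible intrinsic census classes. Conditional; nothing credited.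
[cite: Kato2004Asterisque, Conj. 12.10 (p. 224), Prop. 14.16 (2) (p. 244)] [cite: SilvermanAEC2009, IX.6 Example 6.4]
[cite: MilneADT2006, Thm. I.7.3] [cite: BurungaleFlach2024, Thm. 1.1 and Cor. 2 (p. 4)] -/
theorem stub_lower_red_intrinsic_of_kmcThree_members_of_cmFacts
    (hR : TorsionFree.DescentCountReading IsOf) (hreal : TorsionFree.RealizableOfKMC IsOf KMC)
    (hread : ReadsTrivialKMC IsOf KMC) (hCassels : bsdRHS_eq_of_isIsogenous)
    (hGZK : rank_eq_analyticRank_of_analyticRank_le_one) (hmod : hasEntireLFunction_rat)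
    (hMK : mazurKenku_exists_cyclic_isogeny) (hCM : bsdTriple_of_hasCM_of_L_one_ne_zero)
    (hK : ∀ (W : WeierstrassCurve ℚ) [W.IsElliptic] [W.IsGloballyMinimal],
      W.analyticRank = 0 → Addv W 3 → 0 ≤ padicValRat 3 W.j → ¬ 3 ∣ W.torsionOrder → KMC W 3) :
    ∀ (W : WeierstrassCurve ℚ) [W.IsElliptic] [W.IsGloballyMinimal] [Fact (3 : ℕ).Prime],
      W.analyticRank = 0 → ClassO6 W 3 → ¬ Irr W 3 →
      (∀ (W' : WeierstrassCurve ℚ) [W'.IsElliptic] [W'.IsGloballyMinimal], IsIsogenous W W' →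
        ∀ q' : ℚ, shaAn W' = (q' : ℂ) → 0 < padicValRat 3 q') → MissingLowerBoundAt W 3 :=
  lower_red_intrinsic_of_cmFacts_of_nonCM hCM hmod fun W _ _ _ hr hO _ _ _ ↦
    wildLowerHalfRankZero_of_kmcThree_torsionFree hR hreal hread hCassels hGZK hmod hMK hK W hr hO

/-! ## §5 The v3 composition: the crux BY NAME from published + announced inputs and KMC₃ on exactly
the two non-CM residual row sets -/

/-- **`WildLowerHalfRankZero` from: the published inputs (Cassels `hCassels`, GZK `hGZK`, modularity
`hmod`, Mazur–Kenku `hMK`, Burungale–Flach `hCM`), the two ANNOUNCED inputs (Fouquet–Wan claim shape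
`hFW`; Kim's leaf `hKim` + Kurihara units `hKur`), the reading schemata of Kato's printed theorems
(`hR`, `hreal`, `hread`), and Kato's Conj. 12.10 at `3` displayed on EXACTLY the two non-CM residual row
sets of skeleton v3 (`hKirr`: irreducible, off the FW locus, not a Kim row, non-CM, intrinsic — at the row;
`hKred`: the `3`-torsion-free additive potentially good rank-`0` curves — the members the reducible
intrinsic classes descend from).** Assembled from §§1–4 by this generation's
`wildLowerHalfRankZero_of_v3Stubs_nonCM` (unit classes: Cassels; CM rows: Burungale–Flach; the four roads). This is the kernel statement of the
item's distance from print: two PRE claims and KMC₃ on two named row sets. Conditional; NOT a close.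
[cite: Kato2004Asterisque, Conj. 12.10 (p. 224)] [cite: FouquetWan2021, Thm. 5.1] [cite: Kim2025RefinedTNC, Thm. 1.1/1.2]
[cite: BurungaleFlach2024, Thm. 1.1 and Cor. 2 (p. 4)] [cite: MilneADT2006, Thm. I.7.3] -/
theorem wildLowerHalfRankZero_of_v3Roads (hCassels : bsdRHS_eq_of_isIsogenous)
    (hGZK : rank_eq_analyticRank_of_analyticRank_le_one) (hmod : hasEntireLFunction_rat)
    (hMK : mazurKenku_exists_cyclic_isogeny) (hCM : bsdTriple_of_hasCM_of_L_one_ne_zero)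
    (hFW : FouquetWanClaimShape KMC) (hKim : N11.KimAtThreeRankZeroPUB)
    (hKur : ∀ (W : WeierstrassCurve ℚ) [W.IsElliptic] [W.IsGloballyMinimal],
      W.analyticRank = 0 → ClassO6 W 3 → (∀ n : ℕ, W.HasSurjectiveModNGaloisRep (3 ^ n : ℕ)) →
      Nat.card {Q : (W.baseChange ℚ_[3]).toAffine.Point // (3 : ℕ) • Q = 0} = 1 →
      ¬ 3 ∣ W.tamagawaProduct →
        ∃ (N : ℕ) (_ : NeZero N) (D : ModularParametrizationData W N),
          (∃ u : ℚ, ‖(u : ℚ_[3])‖ = 1 ∧ W.realPeriodRat = u * plusPeriod D.f) ∧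
            X4.KuriharaUnitAt W 3 D.f)
    (hR : TorsionFree.DescentCountReading IsOf) (hreal : TorsionFree.RealizableOfKMC IsOf KMC)
    (hread : ReadsTrivialKMC IsOf KMC)
    (hKirr : ∀ (W : WeierstrassCurve ℚ) [W.IsElliptic] [W.IsGloballyMinimal] [Fact (3 : ℕ).Prime],
      W.analyticRank = 0 → ClassO6 W 3 → Irr W 3 → ¬ (LocIrr W 3 ∧ FWNonsplitRam W 3) →
      ¬ ((∀ n : ℕ, W.HasSurjectiveModNGaloisRep (3 ^ n : ℕ)) ∧
        Nat.card {Q : (W.baseChange ℚ_[3]).toAffine.Point // (3 : ℕ) • Q = 0} = 1 ∧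
        ¬ 3 ∣ W.tamagawaProduct) → ¬ W.HasCM →
      (∀ (W' : WeierstrassCurve ℚ) [W'.IsElliptic] [W'.IsGloballyMinimal], IsIsogenous W W' →
        ∀ q' : ℚ, shaAn W' = (q' : ℂ) → 0 < padicValRat 3 q') → KMC W 3)
    (hKred : ∀ (W : WeierstrassCurve ℚ) [W.IsElliptic] [W.IsGloballyMinimal],
      W.analyticRank = 0 → Addv W 3 → 0 ≤ padicValRat 3 W.j → ¬ 3 ∣ W.torsionOrder → KMC W 3) :
    Summit.BirchSwinnertonDyer.BirchSwinnertonDyer.Theses.KatoDescentPotSupersingular.WildLowerHalfRankZero :=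
  wildLowerHalfRankZero_of_v3Stubs_nonCM ⟨hCassels, hGZK, hmod⟩ hCM
    (stub_lower_irred_fwLocus_of_fwClaim_of_readings hFW hR hreal hread hGZK hmod)
    (stub_lower_kimRows_of_kimAtThree_of_kuriharaUnits hKim hGZK hmod hKur)
    (fun W _ _ _ hr hO hI hloc hKim' _ hint ↦
      stub_lower_irred_residual_of_kmcThree_of_cmFacts hR hreal hread hGZK hmod hCM hKirr W hr hO hI
        hloc hKim' hint)
    (fun W _ _ _ hr hO hI _ hint ↦
      stub_lower_red_intrinsic_of_kmcThree_members_of_cmFacts hR hreal hread hCassels hGZK hmod hMK hCM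
        hKred W hr hO hI hint)

end Summit.BirchSwinnertonDyer.BirchSwinnertonDyer.Theorems

end
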